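import Mathlib
import HarnessLib
import Summits.ResolutionOfSingularities.ResolutionOfSingularities.Theorems.WildQuotientsWildQuotientResolutionS1KillExitDefsTame
import Summits.ResolutionOfSingularities.ResolutionOfSingularities.Theorems.WildQuotientsWildQuotientResolutionS1aStubTameToBR
import Literature.AlgebraicGeometry.Resolution.TameQuotientSingularitiesResolution

/-!
# Line L `s1a-logminvertex`, door ladder rung D0: the v5 DOOR from Bergh–Rydh (crux `CyclicQuotientFourfolds`,
# stmt-ResolutionOfSingularities-17941)

Topic: `Summits/ResolutionOfSingularities/ResolutionOfSingularities/Theorems`. Helper for the crux item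
`CyclicQuotientFourfolds` (stmt-ResolutionOfSingularities-17941, route `WildQuotients`), def-free, `--supports … --as helper`.

The registered skeleton v5 «GLOBAL FRAME + TAME DOOR» (`Cruxes/CyclicQuotientFourfolds/Lines/s1a_logminvertex.lean`,
sha16 47061bb625717adf) carries the scheme-level, `p`-free DOOR

    stub_tameQuotientResolution :
      ∀ (k : Type) [Field k] [PerfectField k] (Y : Scheme.{0}) (g : Y ⟶ Spec (.of k))
        [IsIntegral Y] [IsSeparated g] [LocallyOfFiniteType g] [QuasiCompact g],
        S1.LocallyTameRootRegular Y → topologicalKrullDim Y ≤ 4 → Scheme.HasResolution Y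

(an integral separated quasi-compact `k`-scheme of finite type, `k` perfect, which is locally tame-root-regular and of
dimension `≤ 4`, has a resolution). Rung **D0** of the door ladder (res-L1-w45c-plan-1, EXIT-DOOR-DESIGN v1 §5,
2026-08-27T23:39:37Z) is the CONDITIONAL close of the door from the named fact
`Literature.AlgebraicGeometry.Resolution.BerghRydh2019_diagonalizableQuotientResolution` (Bergh–Rydh 2019, Thm 5,
diagonalizable case): line B's CLOSED chart passage `S1.TameToBR.tameBRExitCover_holds : S1.TameToBR.TameBRExitCover`
(`…S1aStubTameToBR`, after (S1) induced torus + (S2) `exists_slice` + (S3) chart bookkeeping) turns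
`S1.LocallyTameRootRegular Y` into a Bergh–Rydh exit cover `S1.BRExitCover k Y g`, whose binder block is the hypothesis
of the named fact VERBATIM; so the fact resolves `Y` — in EVERY dimension. This makes «line L ⊇ line B at the exit» a
tree theorem: granted Bergh–Rydh, the v5 door holds and the crux reduces to the frame stubs.

* `hasResolution_of_locallyTameRootRegular_of_berghRydh` — all dimensions: Bergh–Rydh ⇒ every integral separated
  finite-type quasi-compact locally tame-root-regular `Y/k` (`k` perfect) has a resolution.
* `door_of_berghRydh` — **D0**: Bergh–Rydh ⇒ the statement of `stub_tameQuotientResolution` VERBATIM.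

Both are CONDITIONAL on the named fact (taken as a hypothesis, not asserted). The OURS proof route of the door
WITHOUT Bergh–Rydh (torification of the residual diagonalizable action + Kato/Nizioł log resolution, rungs D1–D4) is
not touched here. [OURS · L1 W4.5c · door ladder D0] Replaces the role of NO printed item; NOT a statement of the
manuscript [claim: Hironaka2017, status: under-review]. AI work, weaker than expert review.

## References

* D. Bergh, D. Rydh, *Functorial destackification and weak factorization of orbifolds*, arXiv:1905.00872, Thm 5.
  [BerghRydh2019]
* res-L1-w45c-plan-1, EXIT-DOOR-DESIGN v1 (HOME `L/w45c/EXIT-DOOR-DESIGN.md` 0faa10b87b80dece) §1, §5 (OURS, AI planning).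
-/

set_option linter.dupNamespace false -- mandated namespace of this single-conjunct summit

noncomputable section

open CategoryTheory AlgebraicGeometry
open Literature.AlgebraicGeometry.Resolution

namespace Summit.ResolutionOfSingularities.ResolutionOfSingularities.Theorems.WildQuotientResolution.S1.DoorLadder

/-- **Bergh–Rydh ⇒ locally tame-root-regular schemes have resolutions, all dimensions**: for `k` perfect and
`g : Y → Spec k` integral, separated, locally of finite type and quasi-compact, `S1.LocallyTameRootRegular Y` gives a
Bergh–Rydh exit cover (`S1.TameToBR.tameBRExitCover_holds`, line B), and the named fact
`BerghRydh2019_diagonalizableQuotientResolution` resolves `Y`. CONDITIONAL on the named fact. [OURS · L1 W4.5c · D0] -/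
theorem hasResolution_of_locallyTameRootRegular_of_berghRydh
    (hBR : BerghRydh2019_diagonalizableQuotientResolution)
    (k : Type) [Field k] [PerfectField k] (Y : Scheme.{0}) (g : Y ⟶ Spec (.of k))
    [IsIntegral Y] [IsSeparated g] [LocallyOfFiniteType g] [QuasiCompact g]
    (htame : LocallyTameRootRegular Y) : Scheme.HasResolution Y :=
  hBR k Y g (TameToBR.tameBRExitCover_holds k Y g inferInstance htame)

/-- **Rung D0 — the v5 DOOR from Bergh–Rydh**: `BerghRydh2019_diagonalizableQuotientResolution` implies the statement of
the registered stub `stub_tameQuotientResolution` of `Lines/s1a_logminvertex.lean` (47061bb625717adf) VERBATIM (the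
dimension bound `≤ 4` is idle here). CONDITIONAL on the named fact; «line L ⊇ line B at the exit» as a tree theorem.
[OURS · L1 W4.5c · D0] -/
theorem door_of_berghRydh (hBR : BerghRydh2019_diagonalizableQuotientResolution) :
    ∀ (k : Type) [Field k] [PerfectField k] (Y : Scheme.{0}) (g : Y ⟶ Spec (.of k))
      [IsIntegral Y] [IsSeparated g] [LocallyOfFiniteType g] [QuasiCompact g],
      S1.LocallyTameRootRegular Y → topologicalKrullDim Y ≤ 4 →
      Literature.AlgebraicGeometry.Resolution.Scheme.HasResolution Y :=
  fun k _ _ Y g _ _ _ _ htame _ => hasResolution_of_locallyTameRootRegular_of_berghRydh hBR k Y g htame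

end Summit.ResolutionOfSingularities.ResolutionOfSingularities.Theorems.WildQuotientResolution.S1.DoorLadder

end
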